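import Literature.Geometry.Riemannian.IsotropicCurvature
import Literature.Geometry.Riemannian.RiemannianDistance
import Literature.Geometry.Lorentzian.Volume
import Literature.Geometry.Lorentzian.EnergyCurrents
import HarnessLib

/-!
# Chen–Zhu 2014, Corollary 2.2 in dimension four: a conformal class with positive isotropic Yamabe
# invariant contains a metric of positive isotropic curvature

Source: Bing-Long Chen, Xi-Ping Zhu, *A conformally invariant classification theorem in four
dimensions*, Comm. Anal. Geom. **22** (2014) 811–831, arXiv:1206.5051 (**[CZ14]**); the corollary
is attributed there to M. Gursky, C. LeBrun, *On Einstein manifolds of positive sectional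
curvature*, Ann. Global Anal. Geom. **17** (1999) 315–328, Prop. 3 (**[GLe]**).

Printed statements (arXiv text of [CZ14]):

* §2, after (2.8): for a fixed nonnegative homogeneity-one invariant function `f` of the Weyl
  operator, `ℱ_f(Mⁿ,g) = ∫ (R_g − f(W_g)) dv_g / (∫ dv_g)^{1−2/n}`, and with `ĝ = u^{4/(n−2)} g`,
  `R_ĝ − f(W_ĝ) = u^{−(n+2)/(n−2)} [−4(n−1)/(n−2) Δu + (R_g − f(W_g)) u]`, whence
  `ℱ_f(Mⁿ,ĝ) = ∫ ((R_g − f(W_g)) u² + 4(n−1)/(n−2) |∇u|²) dv_g / (∫ u^{2n/(n−2)} dv_g)^{(n−2)/n}`;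
  `𝒴_f(Mⁿ,𝒞) = inf_{g ∈ 𝒞} ℱ_f(Mⁿ,g)`.
* **Corollary 2.2.** "If `𝒴_f(Mⁿ,𝒞) > 0`, then there exists `g̃ ∈ 𝒞` such that
  `R_{g̃} − f(W_{g̃}) > 0`." ("earlier obtained in [GLe] (see Proposition 3 in [GLe])").
* §3, first paragraph: in dimension 4 take `f(W_g) = 6 max{λ_max(W₊), λ_max(W₋)}`,
  `σ_g = R_g − 6 max{λ_max(W₊), λ_max(W₋)}`; "there exists a `g ∈ 𝒞` such that `σ_g > 0`. Since
  both `W₊` and `W₋` are of trace free, this implies the sum of least two eigenvalues of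
  `R_g/12 + W±` is positive. In other words, `(M⁴, g)` has positive isotropic curvature."

Transcription to the tree's vocabulary (`PseudoRiemannianMetric`, `isotropicCurvature` on
orthonormal 4-frames = Micallef–Moore's `K₁₃ + K₁₄ + K₂₃ + K₂₄ − 2R₁₂₃₄`, `gradSq`,
`riemannianMeasure`):
1. In dimension 4 the modified scalar curvature is three times the minimal isotropic curvature,
   `σ_g(x) = 3 · min_e K_iso(e)` (Micallef–Wang 1993, §2; this is the sentence "in other words,
   `(M⁴,g)` has positive isotropic curvature" above), so `f(W) = R − 3 K_min` and the fact is
   phrased with `Literature.Geometry.Riemannian.minIsotropicCurvature` in place of `σ_g`; with `n = 4` the conformal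
   exponent is `u^{4/(n−2)} = u²`, `4(n−1)/(n−2) = 6`, `2n/(n−2) = 4`, so
   `ℱ_f(M⁴, u²g) = ∫ (6 |∇u|² + 3 K_min u²) dv_g / (∫ u⁴ dv_g)^{1/2}` and the hypothesis
   `𝒴_f(M⁴,𝒞_g) > 0` is rendered as `∃ c > 0, ∀ u > 0 smooth, c (∫ u⁴)^{1/2} ≤ ∫ (6·gradSq u + 3 K_min u²)`.
2. The printed `g̃` lies in the enlarged class `𝒞̂_g = {u² g : u > 0, u ∈ C^{2,α}}` (Lemma 2.1);
   the conclusion below asks for a SMOOTH conformal metric `G'` (`G'(v,w) = u² G(v,w)`), which is a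
   transcription STRENGTHENING justified by openness: `σ_{u²g} = u^{−3}(−6Δu + σ_g u)` depends
   continuously on `u` in `C²`, smooth functions are `C²`-dense in `C^{2,α}`, and `σ > 0` on the
   compact `M` is an open condition — so a smooth positive `u` with `σ_{u²g} > 0` exists as soon as a
   `C^{2,α}` one does. Users needing only the printed regularity may weaken the conclusion.
3. Positive isotropic curvature of `G'` is the tree's predicate
   `PseudoRiemannianMetric.HasPositiveIsotropicCurvature` (for every Levi-Civita connection of `G'`).

This fact grounds the route item `Summit.SmoothPoincare4.SmoothPoincare4.Theses.IsotropicCorkBracketing.ConformalPic`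
(stmt-SmoothPoincare4-9827), whose hypothesis is the `L²`-coercivity `c ∫ u² ≤ ∫ (6·gradSq u + 3 μ u²)`
for all `C¹` functions with a continuous lower bound `μ ≤ K_iso`: that implies the hypothesis
below by `μ ≤ K_min` and the Sobolev embedding `H¹ ↪ L⁴` on a compact 4-manifold (first
eigenvalue positive ⇒ Yamabe-type quotient positive), and the item's conclusion (some smooth
Riemannian PIC metric) is weaker than the conformal one here — so item = fact ∘ (Sobolev step),
not an instantiation.
-/

noncomputable section

open scoped Manifold ContDiff
open MeasureTheory

namespace Literature.Geometry.Riemannian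

open Literature.Geometry.Lorentzian (PseudoRiemannianMetric riemannianMeasure)
open Literature.Geometry.Lorentzian.PseudoRiemannianMetric

variable {M : Type*} [TopologicalSpace M] [ChartedSpace (EuclideanSpace ℝ (Fin 4)) M]
  [IsManifold (𝓡 4) ∞ M]

/-- The **minimal isotropic curvature** `K_min(x) = inf {K_iso(e) : e a g-orthonormal 4-frame at x}`
of a 4-manifold at a point (Micallef–Wang 1993, §2; in Chen–Zhu's notation `K_min = σ_g/3`,
`σ_g = R_g − 6 max{λ_max(W₊), λ_max(W₋)}`). An `iInf` over the (compact, for Riemannian `g`)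
set of orthonormal frames; junk `0` if there is no orthonormal 4-frame (non-Riemannian `g`).
[cite: ChenZhu2014, §3 (σ_g)] [cite: MicallefWang1993, §2] -/
def minIsotropicCurvature
    (g : PseudoRiemannianMetric (𝓡 4) ∞ (EuclideanSpace ℝ (Fin 4)) (TangentSpace (𝓡 4) : M → Type _))
    [g.HasLeviCivita] (x : M) : ℝ :=
  ⨅ e : {e : Fin 4 → TangentSpace (𝓡 4) x // g.IsOrthonormalFrame x e},
    g.isotropicCurvature g.leviCivita x e.1

/-- NAMED FACT — **Chen–Zhu 2014, Cor. 2.2 (= Gursky–LeBrun 1999, Prop. 3), dimension four with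
`f(W) = 6 max{λ_max(W₊), λ_max(W₋)}` (Chen–Zhu §3):** "If `𝒴_f(Mⁿ,𝒞) > 0`, then there exists
`g̃ ∈ 𝒞` such that `R_{g̃} − f(W_{g̃}) > 0`", and (§3) "`σ_g > 0` … In other words, `(M⁴,g)` has
positive isotropic curvature." Rendered (see the module docstring for the three transcription
steps: `σ_g = 3 K_min`; `n = 4` exponents `u²`, `6`, `u⁴`; smooth representative): on a closed
smooth 4-manifold with a smooth Riemannian metric `G`, if the isotropic Yamabe quotient is
bounded below on the conformal class — `∃ c > 0, ∀ u > 0 smooth,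
c (∫ u⁴ dV_G)^{1/2} ≤ ∫ (6·gradSq u + 3 K_min u²) dV_G` — then some smooth conformal metric
`G' = u² G` (`u > 0`) is Riemannian with positive isotropic curvature. Users take
`(h : chenZhu2014_conformal_pic_four)`. Grounds
`Summit.SmoothPoincare4.SmoothPoincare4.Theses.IsotropicCorkBracketing.ConformalPic`.
[cite: ChenZhu2014, Cor. 2.2 and §3 (first paragraph of the proof of Thm. 1.1)]
[cite: GurskyLebrun1999, Prop. 3] -/
def chenZhu2014_conformal_pic_four : Prop :=
  ∀ (M : Type) [TopologicalSpace M] [T2Space M] [SecondCountableTopology M]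
    [ChartedSpace (EuclideanSpace ℝ (Fin 4)) M] [IsManifold (𝓡 4) ∞ M] [CompactSpace M]
    [MeasurableSpace M] [BorelSpace M]
    (G : PseudoRiemannianMetric (𝓡 4) ∞ (EuclideanSpace ℝ (Fin 4)) (TangentSpace (𝓡 4) : M → Type _))
    (hG : G.IsRiemannian) [G.HasLeviCivita],
    (∃ c : ℝ, 0 < c ∧ ∀ u : M → ℝ, ContMDiff (𝓡 4) 𝓘(ℝ, ℝ) ∞ u → (∀ x, 0 < u x) →
      c * Real.sqrt (∫ x, u x ^ 4 ∂(riemannianMeasure (G.toContMDiffRiemannianMetric hG))) ≤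
        ∫ x, (6 * G.gradSq u x + 3 * minIsotropicCurvature G x * u x ^ 2)
          ∂(riemannianMeasure (G.toContMDiffRiemannianMetric hG))) →
    ∃ (G' : PseudoRiemannianMetric (𝓡 4) ∞ (EuclideanSpace ℝ (Fin 4)) (TangentSpace (𝓡 4) : M → Type _))
      (u : M → ℝ), (∀ x, 0 < u x) ∧
      (∀ (x : M) (v w : TangentSpace (𝓡 4) x), G'.val x v w = u x ^ 2 * G.val x v w) ∧
      G'.IsRiemannian ∧ G'.HasPositiveIsotropicCurvature

end Literature.Geometry.Riemannian

end
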